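import Summits.CriticalPhenomena.PercolationContinuityZ3.Theorems.PercNearOneGluingNoHeavyLowerTailGeometricMomentCIL
import Literature.Probability.Percolation.GhostVertex
import HarnessLib

/-!
# `NoHeavyLowerTail` (stmt-CriticalPhenomena-4575) — event gluing with ANY constant on UNIFORM STAR SINKS closes the crux

Glue file (`--supports stmt-CriticalPhenomena-4575`; no definitions, no facts, no sorries): the typed
reduction `noHeavyLowerTail_of_geometricMomentCIL` (GM-CIL(C) ⇒ crux, lead gen 4) composed with the
ghost-vertex identities of `Literature.Probability.Percolation.GhostVertex` (Grimmett 1999 §5.3 /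
Aizenman–Barsky 1987 Prop. 2.1: the two GM-CIL polynomials ARE `P(a ↮ g)` and `P(o ↮ g, o ↔ A)` in the
graph enlarged by a ghost `g` joined to every relay with the common weight `1 - v`).

* `noHeavyLowerTail_of_starSinkEventGluing` — if for every finite weighted graph on `Fin n`, nonempty
  relay set `A`, observer `o ∉ A`, `v ∈ (0,1]`, some relay `a` has `P(o ↮ g, o ↔ A) ≤ C · P(a ↮ g)` in
  the enlarged graph `ghostWeights w (starField A v)` (ghost = `none : Option (Fin n)`), then
  `NoHeavyLowerTail`.
* `noHeavyLowerTail_of_starSinkEventGluing_fintype` — the same with the sink a VERTEX `b` of an arbitrary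
  finite vertex type (`b ∉ A`, `b ≠ o`, `b` joined to each relay with weight `1 - v` and to nothing else):
  the shape in which a Kozma–Nitzan-Theorem-3-style proof (B/T decomposition with `T` a uniform star)
  would be stated.  Kozma–Nitzan's Theorem 3 itself gives the case `|A| = 3` with `C = 1`
  (`Literature.Probability.Percolation.KozmaNitzan2024_thm3_gmCIL_three`).
-/

noncomputable section

namespace Summit.CriticalPhenomena.PercolationContinuityZ3.Theorems

open MeasureTheory Set Literature.Probability.LatticeModels Literature.Probability.Percolation
open Literature.Probability.Percolation.GhostVertex
open scoped Classical BigOperators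

/-- **Event gluing with constant `C` towards the ghost of a uniform star sink on the relays implies
`NoHeavyLowerTail`.** [this work; bookkeeping over `noHeavyLowerTail_of_geometricMomentCIL` and
`Literature…gmCIL_of_starSinkEventGluing`] -/
theorem noHeavyLowerTail_of_starSinkEventGluing (C : ℝ) (hC : 0 ≤ C)
    (hEG : ∀ (n : ℕ) (w : Sym2 (Fin n) → unitInterval) (A : Finset (Fin n)) (o : Fin n) (v : unitInterval),
      0 < (v : ℝ) → A.Nonempty → o ∉ A → ∃ a ∈ A,
        (prodBernoulli (ghostWeights w (starField A v))).real
            ((openConn (some o) (none : Option (Fin n)))ᶜ ∩ ⋃ a' ∈ A, openConn (some o) (some a')) ≤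
          C * (prodBernoulli (ghostWeights w (starField A v))).real
            (openConn (some a) (none : Option (Fin n)))ᶜ) :
    Summit.CriticalPhenomena.PercolationContinuityZ3.Theses.PercNearOneGluing.NoHeavyLowerTail :=
  noHeavyLowerTail_of_geometricMomentCIL C hC (gmCIL_of_starSinkEventGluing C hEG)

/-- **Event gluing with constant `C` on every finite graph whose sink is a uniform star on the relays
implies `NoHeavyLowerTail`** (sink-vertex form over arbitrary finite vertex types). [this work] -/
theorem noHeavyLowerTail_of_starSinkEventGluing_fintype (C : ℝ) (hC : 0 ≤ C)
    (hEG : ∀ (W : Type) [Fintype W] (u : Sym2 W → unitInterval) (B : Finset W) (o b : W) (v : unitInterval),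
      0 < (v : ℝ) → B.Nonempty → o ∉ B → b ∉ B → b ≠ o →
      (∀ y, y ∉ B → u s(y, b) = 0) → (∀ a ∈ B, u s(a, b) = unitInterval.symm v) →
      ∃ a ∈ B, (prodBernoulli u).real ((openConn o b)ᶜ ∩ ⋃ a' ∈ B, openConn o a') ≤
        C * (prodBernoulli u).real (openConn a b)ᶜ) :
    Summit.CriticalPhenomena.PercolationContinuityZ3.Theses.PercNearOneGluing.NoHeavyLowerTail :=
  noHeavyLowerTail_of_geometricMomentCIL C hC (gmCIL_of_starSinkEventGluing_fintype C hEG)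

end Summit.CriticalPhenomena.PercolationContinuityZ3.Theorems

end
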